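import Summits.NavierStokesRegularity.NavierStokesRegularity.Theorems.WakeRatchetEternalInviscidRateBlockDSSNoConveyor

/-!
# Conveyor ledger (crux `WakeRatchet.EternalInviscidRate`, ⟨stmt-NavierStokesRegularity-25646⟩) —
# `stub_wakeFloor` READ on period-1 self-similar fronts: the K41 floor is the retention exponent `≥ 5/3 − κ`

Helpers for the open heart stub `stub_wakeFloor` (`∃ κ < 1/2, WakeFloor R κ`) of the registered skeleton «conveyor ledger» (LINE g10-3,
sha16 d183ebc25b56, namespace `…Cruxes.EternalInviscidRate.FinalWakeLedger`).  MODEL lattice only (Tao 2016 §4 renormalised cascade); nothing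
here is a statement about the Navier–Stokes equations, no stub is closed by name, no summit is proved by this file.

For a shell field that is self-similar with shell period ONE, `W_{n+1}(σ) = W_n(σ − T)` (every single-profile DSS front), with per-shell energy
ratio `μ = e^{2T}Λ^{-2}` (`= dssMu ε₀ T`) and final wakes `ω` supplied by hypothesis:
* `finalWake_dss1_succ`, `finalWake_dss1_pow` — the final wakes are geometric: `ω (n+k) = μ^k · ω n`.
* `dss1_wakeFloor_of_mu_le` — if `μ ≤ q` then the inner inequality of `WakeFloor` holds with factor `q` at every shell and every truncation:
  `Σ_{k<K} ω (n+1+k) ≤ q · Σ_{k<K+1} ω (n+k)`.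
* `mu_le_of_dss1_wakeFloor` — conversely, if that inequality holds at ONE shell `n` carrying a wake (`ω n > 0`) for every truncation `K`, and
  `μ ≤ 1` (automatic for bounded admissible fronts: `WakeRatchetDSS.blockRatio_le_one`), then `μ ≤ q`.
Reading (`q = (1+ε₀)^{κ−5/3}`): on single-profile DSS fronts with a wake, `WakeFloor R κ` says EXACTLY `dssMu ≤ (1+ε₀)^{−(5/3−κ)}`, i.e. a
per-shell retention exponent `a_front ≥ 5/3 − κ > 7/6` for the stub's `κ < 1/2` — whereas the crux `EternalInviscidRate` itself reads
`dssMu ≤ (1+ε₀)^{−a}` with any `a > 1` on that stratum (tree: `WakeRatchetTailRatchetDSSVisc`).  The conveyor-ledger line is thus `1/6` STRICTER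
than its crux on DSS fronts (the price of its sloshing budget `γ = 1/6`: `a = 3/2 − κ = (5/3 − κ) − 1/6`).
[cite: Tao2016AveragedNS, §4 Lemma 4.1 (4.8)–(4.10), in the self-similar variables of §6.4; cell vocabulary (`dssMu`)]
-/

noncomputable section

set_option linter.dupNamespace false

open Filter Topology
open Literature.Analysis.FluidPDE Literature.Analysis.FluidPDE.TaoCascade
open Summit.NavierStokesRegularity.NavierStokesRegularity.Theorems

namespace Summit.NavierStokesRegularity.NavierStokesRegularity.Cruxes.EternalInviscidRate.FinalWakeLedger

variable {m : ℕ} {ε₀ : ℝ} {W : ℤ → ℝ → Em m}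

/-- The per-shell ratio of a period-1 self-similar field in block form equals `dssMu`. -/
theorem blockRatio_one_eq_dssMu (hε : 0 < ε₀) (T : ℝ) :
    Real.exp (2 * T) * (bigLam ε₀ ^ (1 : ℕ))⁻¹ ^ 2 = dssMu ε₀ T := by
  have h := WakeRatchetDSS.blockRatio_orderOf_eq_pow (ε₀ := ε₀) hε.le 1 T
  simpa using h

/-- Period-1 self-similarity: consecutive final wakes scale by `μ = dssMu ε₀ T`. -/
theorem finalWake_dss1_succ (hε : 0 < ε₀) {T : ℝ} (hD : ∀ (n : ℤ) (σ : ℝ), W (n + 1) σ = W n (σ - T))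
    {ω : ℤ → ℝ} (hω : ∀ k : ℤ, Tendsto (physEnergy ε₀ W k) atTop (𝓝 (ω k))) (n : ℤ) :
    ω (n + 1) = dssMu ε₀ T * ω n := by
  have hD' : ∀ (n : ℤ) (σ : ℝ), W (n + ((1 : ℕ) : ℤ)) σ = W n (σ - T) := fun n σ => by
    rw [Nat.cast_one]; exact hD n σ
  have h := finalWake_blockShift hε hD' hω n
  rw [Nat.cast_one, blockRatio_one_eq_dssMu hε] at h
  exact h

/-- Hence the final wakes are geometric: `ω (n+k) = μ^k · ω n`. -/
theorem finalWake_dss1_pow (hε : 0 < ε₀) {T : ℝ} (hD : ∀ (n : ℤ) (σ : ℝ), W (n + 1) σ = W n (σ - T))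
    {ω : ℤ → ℝ} (hω : ∀ k : ℤ, Tendsto (physEnergy ε₀ W k) atTop (𝓝 (ω k))) (n : ℤ) (k : ℕ) :
    ω (n + k) = dssMu ε₀ T ^ k * ω n := by
  induction k with
  | zero => simp
  | succ k ih =>
    rw [show n + ((k + 1 : ℕ) : ℤ) = n + k + 1 by push_cast; ring, finalWake_dss1_succ hε hD hω, ih, pow_succ]
    ring

/-- **`μ ≤ q` ⇒ the wake floor with factor `q`.**  For a period-1 self-similar field with `dssMu ε₀ T ≤ q`, the inner inequality of
`WakeFloor` holds with factor `q` at every shell and every truncation. -/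
theorem dss1_wakeFloor_of_mu_le (hε : 0 < ε₀) {T : ℝ} (hD : ∀ (n : ℤ) (σ : ℝ), W (n + 1) σ = W n (σ - T))
    {ω : ℤ → ℝ} (hω : ∀ k : ℤ, Tendsto (physEnergy ε₀ W k) atTop (𝓝 (ω k))) {q : ℝ} (hμq : dssMu ε₀ T ≤ q)
    (n : ℤ) (K : ℕ) :
    ∑ k ∈ Finset.range K, ω (n + 1 + k) ≤ q * ∑ k ∈ Finset.range (K + 1), ω (n + k) := by
  have hμ0 : 0 ≤ dssMu ε₀ T := (dssMu_pos T (by linarith)).le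
  have hω0 : ∀ k : ℤ, 0 ≤ ω k := fun k => finalWake_nonneg hω k
  have hshift : ∑ k ∈ Finset.range K, ω (n + 1 + k) = dssMu ε₀ T * ∑ k ∈ Finset.range K, ω (n + k) := by
    rw [Finset.mul_sum]
    refine Finset.sum_congr rfl fun k _ => ?_
    rw [show n + 1 + (k : ℤ) = n + k + 1 by ring]
    exact finalWake_dss1_succ hε hD hω (n + k)
  have hS0 : 0 ≤ ∑ k ∈ Finset.range (K + 1), ω (n + k) := Finset.sum_nonneg fun k _ => hω0 _
  have hmono : ∑ k ∈ Finset.range K, ω (n + k) ≤ ∑ k ∈ Finset.range (K + 1), ω (n + k) := by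
    rw [Finset.sum_range_succ]; linarith [hω0 (n + K)]
  rw [hshift]
  calc dssMu ε₀ T * ∑ k ∈ Finset.range K, ω (n + k)
      ≤ dssMu ε₀ T * ∑ k ∈ Finset.range (K + 1), ω (n + k) := mul_le_mul_of_nonneg_left hmono hμ0
    _ ≤ q * ∑ k ∈ Finset.range (K + 1), ω (n + k) := mul_le_mul_of_nonneg_right hμq hS0

/-- **The wake floor at one wake-carrying shell ⇒ `μ ≤ q`.**  For a period-1 self-similar field with `dssMu ε₀ T ≤ 1`, if the inner inequality
of `WakeFloor` with factor `q` holds at a shell `n` with `ω n > 0` for every truncation `K`, then `dssMu ε₀ T ≤ q`. -/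
theorem mu_le_of_dss1_wakeFloor (hε : 0 < ε₀) {T : ℝ} (hD : ∀ (n : ℤ) (σ : ℝ), W (n + 1) σ = W n (σ - T))
    {ω : ℤ → ℝ} (hω : ∀ k : ℤ, Tendsto (physEnergy ε₀ W k) atTop (𝓝 (ω k))) (hμ1 : dssMu ε₀ T ≤ 1)
    {q : ℝ} {n : ℤ} (hn : 0 < ω n)
    (hWF : ∀ K : ℕ, ∑ k ∈ Finset.range K, ω (n + 1 + k) ≤ q * ∑ k ∈ Finset.range (K + 1), ω (n + k)) :
    dssMu ε₀ T ≤ q := by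
  set μ : ℝ := dssMu ε₀ T with hμdef
  have hμ0 : 0 < μ := dssMu_pos T (by linarith)
  -- geometric sums `S K = Σ_{k<K} μ^k`
  have hsum : ∀ K : ℕ, ∑ k ∈ Finset.range K, ω (n + k) = ω n * ∑ k ∈ Finset.range K, μ ^ k := by
    intro K
    rw [Finset.mul_sum]
    exact Finset.sum_congr rfl fun k _ => by rw [finalWake_dss1_pow hε hD hω n k]; ring
  have hshift : ∀ K : ℕ, ∑ k ∈ Finset.range K, ω (n + 1 + k) = μ * ∑ k ∈ Finset.range K, ω (n + k) := by
    intro K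
    rw [Finset.mul_sum]
    refine Finset.sum_congr rfl fun k _ => ?_
    rw [show n + 1 + (k : ℤ) = n + k + 1 by ring]
    exact finalWake_dss1_succ hε hD hω (n + k)
  -- the floor in geometric form: `μ · S K ≤ q · S (K+1)` with `S (K+1) = S K + μ^K`
  have hgeo : ∀ K : ℕ, μ * ∑ k ∈ Finset.range K, μ ^ k ≤ q * (∑ k ∈ Finset.range K, μ ^ k + μ ^ K) := by
    intro K
    have h := hWF K
    rw [hshift, hsum K, hsum (K + 1), Finset.sum_range_succ] at h
    have h' : ω n * (μ * ∑ k ∈ Finset.range K, μ ^ k) ≤ ω n * (q * (∑ k ∈ Finset.range K, μ ^ k + μ ^ K)) := by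
      linarith
    exact le_of_mul_le_mul_left h' hn
  by_contra hlt
  push Not at hlt
  -- `q ≥ 0` from `K = 1`
  have hq0 : 0 < q := by
    have h := hgeo 1
    simp only [Finset.sum_range_one, pow_zero, pow_one, mul_one] at h
    nlinarith
  rcases hμ1.lt_or_eq with hμlt | hμeq
  · -- `μ < 1`: `(μ − q) ≤ (μ − q)·S K ≤ q μ^K → 0`
    have hgap : 0 < μ - q := by linarith
    obtain ⟨K, hK⟩ := exists_pow_lt_of_lt_one (show 0 < (μ - q) / (q + 1) by positivity) hμlt
    have hSK : 1 ≤ ∑ k ∈ Finset.range (K + 1), μ ^ k := by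
      rw [Finset.sum_range_succ']
      simp only [pow_zero]
      linarith [Finset.sum_nonneg (fun k (_ : k ∈ Finset.range K) => pow_nonneg hμ0.le (k + 1))]
    have h := hgeo (K + 1)
    have hKp : μ ^ (K + 1) ≤ μ ^ K := by
      rw [pow_succ]; exact mul_le_of_le_one_right (pow_nonneg hμ0.le K) hμ1
    have h1 : (μ - q) * ∑ k ∈ Finset.range (K + 1), μ ^ k ≤ q * μ ^ K := by nlinarith
    have h2 : μ - q ≤ q * μ ^ K := le_trans (by nlinarith) h1
    have h3 : q * μ ^ K < q * ((μ - q) / (q + 1)) := mul_lt_mul_of_pos_left hK hq0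
    have h4 : q * ((μ - q) / (q + 1)) < μ - q := by
      rw [mul_div_assoc', div_lt_iff₀ (by linarith : (0 : ℝ) < q + 1)]
      nlinarith
    linarith
  · -- `μ = 1`: `K ≤ q (K+1)` for all `K` forces `q ≥ 1`
    have hone : ∀ K : ℕ, ∑ k ∈ Finset.range K, μ ^ k = K := by
      intro K; rw [hμeq]; simp
    have hK : ∀ K : ℕ, (K : ℝ) ≤ q * ((K : ℝ) + 1) := by
      intro K
      have h := hgeo K
      rw [hone K, hμeq, one_pow, one_mul] at h
      exact h
    have hq1 : q < 1 := by rw [hμeq] at hlt; exact hlt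
    obtain ⟨K, hKq⟩ := exists_nat_gt (q / (1 - q))
    have h := hK K
    have h1 : (K : ℝ) * (1 - q) ≤ q := by nlinarith
    have h2 : q / (1 - q) < K := hKq
    rw [div_lt_iff₀ (by linarith : (0 : ℝ) < 1 - q)] at h2
    linarith

end Summit.NavierStokesRegularity.NavierStokesRegularity.Cruxes.EternalInviscidRate.FinalWakeLedger

end
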